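import Summits.CriticalPhenomena.SAWScalingLimit.Theorems.SAWTotalPositivityBoundaryTP2Defs
import Summits.CriticalPhenomena.SAWScalingLimit.Theorems.SAWTotalPositivityBoundaryTP2Kernel
import Summits.CriticalPhenomena.SAWScalingLimit.Theorems.SAWTotalPositivityBoundaryTP2Symmetry
import Summits.CriticalPhenomena.SAWScalingLimit.Theorems.SAWTotalPositivityBoundaryTP2RectReflect
import Summits.CriticalPhenomena.SAWScalingLimit.Theorems.EdgeOfPositivity.Negative.EdgeOfPositivityRectDomain
import HarnessLib

/-!
# Crux `BoundaryTP2` (stmt-CriticalPhenomena-7115), line `Sketch`: stub `stub_strip3_endLower`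

Tool stub C6 of the line's skeleton: lower bounds for the left-END kernels of the 3-row strip
`S_L = {0..L} × {0,1,2}` (`discreteDomainGraph (rectDomain L 2) 1`), `L ≥ 1`, by explicit short
self-avoiding paths inside the first two columns:

* `(0,0) → (0,2)`: the column segment (length `2`) and the three detours through column `1`
  (length `4` each) give `x² + 3x⁴`;
* `(0,0) → (0,1)`: the edge, the way around the near unit square and the way around the whole
  `2 × 3` block give `x + x³ + x⁵`;
* `(0,1) → (0,2)`: the reflection `j ↦ 2 - j` of the strip (`stub_rect_reflect`) reduces it to the
  previous bound.

A list of self-avoiding paths with pairwise distinct vertex lists contributes the sum of its weights to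
the kernel (`ENNReal.sum_le_tsum`); distinctness and self-avoidance are decided on coordinate lists.
-/

noncomputable section

namespace Summit.CriticalPhenomena.SAWScalingLimit.Theorems.BoundaryTP2

open Literature.Probability.LatticeModels Literature.Probability.RandomPlanarGeometry
open Summit.CriticalPhenomena.SAWScalingLimit.Theorems.EdgeOfPositivity.Negative
open scoped ENNReal

/-! ### Coordinate bookkeeping -/

/-- Adjacency in `ℤ²` in coordinates: one coordinate differs by `1`, the other agrees. [folklore] -/
private theorem s3el_zd_adj_iff (u v : Site 2) :
    (zdGraph 2).Adj u v ↔
      ((v 0 = u 0 + 1 ∨ u 0 = v 0 + 1) ∧ v 1 = u 1) ∨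
        ((v 1 = u 1 + 1 ∨ u 1 = v 1 + 1) ∧ v 0 = u 0) := by
  -- adapted from `ladder_zd_adj_iff` in `…BoundaryTP2LadderKernels`
  rw [zdGraph_adj_iff, Fin.exists_fin_two]
  simp only [funext_iff, Fin.forall_fin_two, Pi.add_apply, Pi.single_eq_same,
    Pi.single_eq_of_ne (one_ne_zero : (1 : Fin 2) ≠ 0),
    Pi.single_eq_of_ne (zero_ne_one : (0 : Fin 2) ≠ 1), add_zero]
  omega

/-- Adjacency of two explicitly given sites of the strip `{0..L} × {0,1,2}`, in coordinates.
[folklore] -/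
private theorem s3el_adj_iff (L : ℕ) (i j i' j' : ℤ) :
    (discreteDomainGraph (rectDomain L 2) 1).Adj (st i j) (st i' j') ↔
      (((i' = i + 1 ∨ i = i' + 1) ∧ j' = j) ∨ ((j' = j + 1 ∨ j = j' + 1) ∧ i' = i)) ∧
        ((0 ≤ i ∧ i ≤ L) ∧ (0 ≤ j ∧ j ≤ 2)) ∧ ((0 ≤ i' ∧ i' ≤ L) ∧ (0 ≤ j' ∧ j' ≤ 2)) := by
  rw [adj_rect_iff, s3el_zd_adj_iff, mem_rectSites_iff, mem_rectSites_iff]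
  simp only [st_zero, st_one]
  omega

/-- A walk whose list of vertex coordinates has no duplicate is a self-avoiding path. [folklore] -/
private theorem s3el_isPath {H : SimpleGraph (Site 2)} {a b : Site 2} (w : H.Walk a b)
    (h : (w.support.map fun v => (v 0, v 1)).Nodup) : w.IsPath :=
  (SimpleGraph.Walk.isPath_def w).2 (h.of_map _)

/-- A list of self-avoiding paths with pairwise distinct lists of vertex coordinates contributes the
sum of its weights `x^{|γ|}` to the path kernel. [folklore] -/
private theorem s3el_sum_le {H : SimpleGraph (Site 2)} (x : ℝ) {a b : Site 2} (l : List (H.Path a b))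
    (hl : (l.map fun γ => γ.1.support.map fun v => (v 0, v 1)).Nodup) :
    (l.map fun γ => ENNReal.ofReal (x ^ γ.1.length)).sum ≤ pathKernel H x a b := by
  classical
  rw [← List.sum_toFinset _ (hl.of_map _)]
  exact ENNReal.sum_le_tsum _

/-! ### The three lower bounds -/

/-- `Z((0,0),(0,2)) ≥ x² + 3x⁴` on the strip `{0..L} × {0,1,2}`, `L ≥ 1`: the paths
`00-01-02`, `00-10-11-01-02`, `00-01-11-12-02`, `00-10-11-12-02`. [folklore] -/
private theorem s3el_corner (L : ℕ) (hL : 1 ≤ L) {x : ℝ} (hx : 0 ≤ x) :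
    ENNReal.ofReal (x ^ 2 + 3 * x ^ 4) ≤
      pathKernel (discreteDomainGraph (rectDomain L 2) 1) x (st 0 0) (st 0 2) := by
  -- the edges used (directed as traversed)
  have e0001 : (discreteDomainGraph (rectDomain L 2) 1).Adj (st 0 0) (st 0 1) :=
    (s3el_adj_iff L 0 0 0 1).2 (by omega)
  have e0102 : (discreteDomainGraph (rectDomain L 2) 1).Adj (st 0 1) (st 0 2) :=
    (s3el_adj_iff L 0 1 0 2).2 (by omega)
  have e0010 : (discreteDomainGraph (rectDomain L 2) 1).Adj (st 0 0) (st 1 0) :=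
    (s3el_adj_iff L 0 0 1 0).2 (by omega)
  have e1011 : (discreteDomainGraph (rectDomain L 2) 1).Adj (st 1 0) (st 1 1) :=
    (s3el_adj_iff L 1 0 1 1).2 (by omega)
  have e1101 : (discreteDomainGraph (rectDomain L 2) 1).Adj (st 1 1) (st 0 1) :=
    (s3el_adj_iff L 1 1 0 1).2 (by omega)
  have e1112 : (discreteDomainGraph (rectDomain L 2) 1).Adj (st 1 1) (st 1 2) :=
    (s3el_adj_iff L 1 1 1 2).2 (by omega)
  have e1202 : (discreteDomainGraph (rectDomain L 2) 1).Adj (st 1 2) (st 0 2) :=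
    (s3el_adj_iff L 1 2 0 2).2 (by omega)
  -- the four paths, remembered through their supports and lengths only
  obtain ⟨γ₁, s₁, l₁⟩ : ∃ γ : (discreteDomainGraph (rectDomain L 2) 1).Path (st 0 0) (st 0 2),
      γ.1.support = [st 0 0, st 0 1, st 0 2] ∧ γ.1.length = 2 :=
    ⟨⟨SimpleGraph.Walk.cons e0001 (SimpleGraph.Walk.cons e0102 SimpleGraph.Walk.nil),
      s3el_isPath _ (by
        simp only [SimpleGraph.Walk.support_cons, SimpleGraph.Walk.support_nil, List.map_cons,
          List.map_nil, st_zero, st_one]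
        decide)⟩, rfl, rfl⟩
  obtain ⟨γ₂, s₂, l₂⟩ : ∃ γ : (discreteDomainGraph (rectDomain L 2) 1).Path (st 0 0) (st 0 2),
      γ.1.support = [st 0 0, st 1 0, st 1 1, st 0 1, st 0 2] ∧ γ.1.length = 4 :=
    ⟨⟨SimpleGraph.Walk.cons e0010 (SimpleGraph.Walk.cons e1011 (SimpleGraph.Walk.cons e1101
        (SimpleGraph.Walk.cons e0102 SimpleGraph.Walk.nil))),
      s3el_isPath _ (by
        simp only [SimpleGraph.Walk.support_cons, SimpleGraph.Walk.support_nil, List.map_cons,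
          List.map_nil, st_zero, st_one]
        decide)⟩, rfl, rfl⟩
  obtain ⟨γ₃, s₃, l₃⟩ : ∃ γ : (discreteDomainGraph (rectDomain L 2) 1).Path (st 0 0) (st 0 2),
      γ.1.support = [st 0 0, st 0 1, st 1 1, st 1 2, st 0 2] ∧ γ.1.length = 4 :=
    ⟨⟨SimpleGraph.Walk.cons e0001 (SimpleGraph.Walk.cons e1101.symm (SimpleGraph.Walk.cons e1112
        (SimpleGraph.Walk.cons e1202 SimpleGraph.Walk.nil))),
      s3el_isPath _ (by
        simp only [SimpleGraph.Walk.support_cons, SimpleGraph.Walk.support_nil, List.map_cons,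
          List.map_nil, st_zero, st_one]
        decide)⟩, rfl, rfl⟩
  obtain ⟨γ₄, s₄, l₄⟩ : ∃ γ : (discreteDomainGraph (rectDomain L 2) 1).Path (st 0 0) (st 0 2),
      γ.1.support = [st 0 0, st 1 0, st 1 1, st 1 2, st 0 2] ∧ γ.1.length = 4 :=
    ⟨⟨SimpleGraph.Walk.cons e0010 (SimpleGraph.Walk.cons e1011 (SimpleGraph.Walk.cons e1112
        (SimpleGraph.Walk.cons e1202 SimpleGraph.Walk.nil))),
      s3el_isPath _ (by
        simp only [SimpleGraph.Walk.support_cons, SimpleGraph.Walk.support_nil, List.map_cons,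
          List.map_nil, st_zero, st_one]
        decide)⟩, rfl, rfl⟩
  -- they are pairwise distinct, hence contribute `x² + x⁴ + x⁴ + x⁴`
  have key := s3el_sum_le x [γ₁, γ₂, γ₃, γ₄] (by
    simp only [List.map_cons, List.map_nil, s₁, s₂, s₃, s₄, st_zero, st_one]
    decide)
  simp only [List.map_cons, List.map_nil, List.sum_cons, List.sum_nil, l₁, l₂, l₃, l₄,
    add_zero] at key
  have h4 : (0 : ℝ) ≤ x ^ 4 := pow_nonneg hx 4
  have hre : x ^ 2 + 3 * x ^ 4 = x ^ 2 + (x ^ 4 + (x ^ 4 + x ^ 4)) := by ring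
  rw [hre, ENNReal.ofReal_add (pow_nonneg hx 2) (by positivity), ENNReal.ofReal_add h4 (by positivity),
    ENNReal.ofReal_add h4 h4]
  exact key

/-- `Z((0,0),(0,1)) ≥ x + x³ + x⁵` on the strip `{0..L} × {0,1,2}`, `L ≥ 1`: the paths `00-01`,
`00-10-11-01`, `00-10-11-12-02-01`. [folklore] -/
private theorem s3el_lowerEdge (L : ℕ) (hL : 1 ≤ L) {x : ℝ} (hx : 0 ≤ x) :
    ENNReal.ofReal (x + x ^ 3 + x ^ 5) ≤
      pathKernel (discreteDomainGraph (rectDomain L 2) 1) x (st 0 0) (st 0 1) := by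
  -- the edges used (directed as traversed)
  have e0001 : (discreteDomainGraph (rectDomain L 2) 1).Adj (st 0 0) (st 0 1) :=
    (s3el_adj_iff L 0 0 0 1).2 (by omega)
  have e0010 : (discreteDomainGraph (rectDomain L 2) 1).Adj (st 0 0) (st 1 0) :=
    (s3el_adj_iff L 0 0 1 0).2 (by omega)
  have e1011 : (discreteDomainGraph (rectDomain L 2) 1).Adj (st 1 0) (st 1 1) :=
    (s3el_adj_iff L 1 0 1 1).2 (by omega)
  have e1101 : (discreteDomainGraph (rectDomain L 2) 1).Adj (st 1 1) (st 0 1) :=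
    (s3el_adj_iff L 1 1 0 1).2 (by omega)
  have e1112 : (discreteDomainGraph (rectDomain L 2) 1).Adj (st 1 1) (st 1 2) :=
    (s3el_adj_iff L 1 1 1 2).2 (by omega)
  have e1202 : (discreteDomainGraph (rectDomain L 2) 1).Adj (st 1 2) (st 0 2) :=
    (s3el_adj_iff L 1 2 0 2).2 (by omega)
  have e0201 : (discreteDomainGraph (rectDomain L 2) 1).Adj (st 0 2) (st 0 1) :=
    (s3el_adj_iff L 0 2 0 1).2 (by omega)
  -- the three paths, remembered through their supports and lengths only
  obtain ⟨γ₁, s₁, l₁⟩ : ∃ γ : (discreteDomainGraph (rectDomain L 2) 1).Path (st 0 0) (st 0 1),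
      γ.1.support = [st 0 0, st 0 1] ∧ γ.1.length = 1 :=
    ⟨⟨SimpleGraph.Walk.cons e0001 SimpleGraph.Walk.nil,
      s3el_isPath _ (by
        simp only [SimpleGraph.Walk.support_cons, SimpleGraph.Walk.support_nil, List.map_cons,
          List.map_nil, st_zero, st_one]
        decide)⟩, rfl, rfl⟩
  obtain ⟨γ₂, s₂, l₂⟩ : ∃ γ : (discreteDomainGraph (rectDomain L 2) 1).Path (st 0 0) (st 0 1),
      γ.1.support = [st 0 0, st 1 0, st 1 1, st 0 1] ∧ γ.1.length = 3 :=
    ⟨⟨SimpleGraph.Walk.cons e0010 (SimpleGraph.Walk.cons e1011 (SimpleGraph.Walk.cons e1101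
        SimpleGraph.Walk.nil)),
      s3el_isPath _ (by
        simp only [SimpleGraph.Walk.support_cons, SimpleGraph.Walk.support_nil, List.map_cons,
          List.map_nil, st_zero, st_one]
        decide)⟩, rfl, rfl⟩
  obtain ⟨γ₃, s₃, l₃⟩ : ∃ γ : (discreteDomainGraph (rectDomain L 2) 1).Path (st 0 0) (st 0 1),
      γ.1.support = [st 0 0, st 1 0, st 1 1, st 1 2, st 0 2, st 0 1] ∧ γ.1.length = 5 :=
    ⟨⟨SimpleGraph.Walk.cons e0010 (SimpleGraph.Walk.cons e1011 (SimpleGraph.Walk.cons e1112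
        (SimpleGraph.Walk.cons e1202 (SimpleGraph.Walk.cons e0201 SimpleGraph.Walk.nil)))),
      s3el_isPath _ (by
        simp only [SimpleGraph.Walk.support_cons, SimpleGraph.Walk.support_nil, List.map_cons,
          List.map_nil, st_zero, st_one]
        decide)⟩, rfl, rfl⟩
  -- they are pairwise distinct, hence contribute `x + x³ + x⁵`
  have key := s3el_sum_le x [γ₁, γ₂, γ₃] (by
    simp only [List.map_cons, List.map_nil, s₁, s₂, s₃, st_zero, st_one]
    decide)
  simp only [List.map_cons, List.map_nil, List.sum_cons, List.sum_nil, l₁, l₂, l₃, add_zero,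
    pow_one] at key
  have hre : x + x ^ 3 + x ^ 5 = x + (x ^ 3 + x ^ 5) := by ring
  rw [hre, ENNReal.ofReal_add hx (by positivity), ENNReal.ofReal_add (pow_nonneg hx 3) (pow_nonneg hx 5)]
  exact key

/-- `Z((0,1),(0,2)) ≥ x + x³ + x⁵` on the strip `{0..L} × {0,1,2}`, `L ≥ 1`, from the previous bound
by the reflection `j ↦ 2 - j` of the strip and the symmetry of the kernel. [folklore] -/
private theorem s3el_upperEdge (L : ℕ) (hL : 1 ≤ L) {x : ℝ} (hx : 0 ≤ x) :
    ENNReal.ofReal (x + x ^ 3 + x ^ 5) ≤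
      pathKernel (discreteDomainGraph (rectDomain L 2) 1) x (st 0 1) (st 0 2) := by
  have h := (stub_rect_reflect L 2 x 0 1 0 2).2
  norm_num at h
  rw [h, pathKernel_comm]
  exact s3el_lowerEdge L hL hx

/-! ### The registered stub -/

/-- **Tool stub `stub_strip3_endLower`** (C6). Lower bounds for the left-END kernels of every strip
of length `L ≥ 1` by explicit short paths inside the first two columns: `(0,0) → (0,2)` directly or
by one of the three detours through column `1` (`x² + 3x⁴`), and `(0,0) → (0,1)`, `(0,1) → (0,2)`
directly, around the near unit square, or around the whole `3 × 2` block (`x + x³ + x⁵`).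
[folklore] -/
theorem stub_strip3_endLower (L : ℕ) (hL : 1 ≤ L) {x : ℝ} (hx : 0 ≤ x) :
    ENNReal.ofReal (x ^ 2 + 3 * x ^ 4) ≤
        pathKernel (discreteDomainGraph (rectDomain L 2) 1) x (st 0 0) (st 0 2) ∧
      ENNReal.ofReal (x + x ^ 3 + x ^ 5) ≤
        pathKernel (discreteDomainGraph (rectDomain L 2) 1) x (st 0 0) (st 0 1) ∧
      ENNReal.ofReal (x + x ^ 3 + x ^ 5) ≤
        pathKernel (discreteDomainGraph (rectDomain L 2) 1) x (st 0 1) (st 0 2) :=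
  ⟨s3el_corner L hL hx, s3el_lowerEdge L hL hx, s3el_upperEdge L hL hx⟩

end Summit.CriticalPhenomena.SAWScalingLimit.Theorems.BoundaryTP2
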